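import Mathlib
import HarnessLib
import HarnessLib.Audit
import Summits.SmoothPoincare4.Statement
import Literature.Topology.FourManifolds.HomotopySpheres
import Literature.Topology.FourManifolds.Cobordism
import Literature.Topology.FourManifolds.Gluing
import Literature.Geometry.Lorentzian.PseudoRiemannianMetric
import Literature.Geometry.Lorentzian.LeviCivita
import Literature.Geometry.Lorentzian.Hypersurface
import Literature.Geometry.Lorentzian.Isometry
import Literature.Geometry.Lorentzian.IsometryProofs

/-!
Route: PscCorkFillIn

CLOSED (retired) 2026-08-15T13:51:33Z by operator:999:1257524 — reason: not-a-thesis: assembly does not conclude the sub-problem Statement — note: D-0027 §2.1 audit (human 2026-08-15: routes that do not decide the summit are removed): the assembly concludes `PscAllHomotopySpheres`, not the sub-problem statement; a NEW conforming route may be opened from the same idea (generated `closes : … → _root_.SmoothPoincare4`).. The file is kept as the record of this route; refuted decls are indexed as negative knowledge (`ledger negatives`).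

# Route PscCorkFillIn — PSC on homotopy 4-spheres as a two-sided Bartnik fill-in problem on the cork
pieces of S⁴ — Bär–Hanke gluing, and τ-invariance of PSC fill-in regions

SUB-TARGET ROUTE (positive side; the wall is route PIC's crux `PicPscV2` =
stmt-SmoothPoincare4-0442, "every homotopy
4-sphere admits a metric of positive scalar curvature", which PIC's header records with "no
mechanism"; PSC-ALL is necessary
for SPC4 and does not imply it, and this route does not pretend otherwise — pattern of route
CsArithmeticWalk). It realises card
psc-cork-fillin, corrected (see Why this line). It suffices to show X = TwistedFillIn: for every
splitting of the standard
sphere S⁴ = C ∪_φ W into a compact contractible piece C and a compact piece W glued along φ : ∂C ≅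
∂W, and every
self-diffeomorphism τ of ∂C, the TWISTED pair admits COMPATIBLE PSC FILL-INS: Riemannian metrics g_C
on C and g_W on W of
positive scalar curvature whose induced boundary metrics agree under φ∘τ and whose mean curvatures
(trace of the second
fundamental form for the OUTWARD unit normal, the tree's sign: the unit ball of ℝ⁴ has +3) satisfy
H_C(z) + H_W(φ(τ z)) ≥ 0.
By Bär–Hanke's smoothing of mean-convex singularities (BarHanke2023 §4.4, Thm 42 of arXiv:2012.09127
= Thm 4.11 publ.)
such a pair glues to a smooth PSC metric on C ∪_{φ∘τ} W; by the cork theorem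
(CurtisFreedmanHsiangStong1996, Matveyev1996)
and Θ₄ = 0 (KervaireMilnorAnnals1963) every homotopy 4-sphere is such a twist of S⁴, so X ⇒ PSC-ALL
(Assembly, PROVED in the
planner's SketchProofs.lean modulo the two named facts taken as hypotheses). Conversely a PSC metric
on the twist restricts to
such a pair (support RestrictionToPieces) and every regluing of a contractible piece of S⁴ is a
homotopy 4-sphere, so X ⇔ PSC-ALL:
no slack is lost, but the unknown manifold is replaced by two explicit compact pieces OF THE ROUND
SPHERE and their PSC fill-in
regions ℱ(P) = {(boundary metric h, outward mean curvature ≥ H)} — downward closed in H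
(BarHanke2023 Rem. 37), unconstrained
in h (ShiWangWei2022 Thm 1.1 = support FlexBoundaryMetric), bounded above in H (Miao2021,
ShiWangWei2022 Thm 1.2). In this
language X says ℱ(C) ∩ τ^*ℱ^φ(W) ≠ ∅, while S⁴ itself gives ℱ(C) ∩ ℱ^φ(W) ≠ ∅ — the card's "J_A ∩
τ·J_C ≠ ∅".
Lean: `∀ (C : Type) [TopologicalSpace C] [T2Space C] [SecondCountableTopology C] [ChartedSpace
(EuclideanHalfSpace 4) C] [IsManifold (𝓡∂ 4) ∞ C] [CompactSpace C] [ContractibleSpace C] (bC :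
Literature.Topology.FourManifolds.BoundaryData (𝓡∂ 4) C (𝓡 3)) (W : Type) [TopologicalSpace W]
[T2Space W] [SecondCountableTopology W] [ChartedSpace (EuclideanHalfSpace 4) W] [IsManifold (𝓡∂ 4) ∞
W] [CompactSpace W] (bW : Literature.Topology.FourManifolds.BoundaryData (𝓡∂ 4) W (𝓡 3)) (φ :
bC.carrier ≃ₘ⟮𝓡 3, 𝓡 3⟯ bW.carrier) (τ : bC.carrier ≃ₘ⟮𝓡 3, 𝓡 3⟯ bC.carrier),
Literature.Topology.FourManifolds.IsBoundaryGluing bC bW φ (𝓡 4) (Metric.sphere (0 : EuclideanSpace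
ℝ (Fin 5)) 1) → ∃ gC : Literature.Geometry.Lorentzian.PseudoRiemannianMetric (𝓡∂ 4) ∞
(EuclideanSpace ℝ (Fin 4)) (TangentSpace (𝓡∂ 4) : C → Type _), ∃ _ : gC.HasLeviCivita, ∃ hfC :
gC.IsSpacelikeImmersion (𝓡 3) bC.incl, ∃ νC : Literature.Geometry.Lorentzian.NormalField (𝓡∂ 4)
bC.incl, ∃ gW : Literature.Geometry.Lorentzian.PseudoRiemannianMetric (𝓡∂ 4) ∞ (EuclideanSpace ℝ
(Fin 4)) (TangentSpace (𝓡∂ 4) : W → Type _), ∃ _ : gW.HasLeviCivita, ∃ hfW : gW.IsSpacelikeImmersion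
(𝓡 3) bW.incl, ∃ νW : Literature.Geometry.Lorentzian.NormalField (𝓡∂ 4) bW.incl, (gC.IsRiemannian ∧
(∀ x, 0 < gC.scalarCurvature x) ∧ gC.IsUnitNormal (𝓡 3) bC.incl νC 1 ∧ ContMDiff (𝓡 3) (𝓡∂
4).tangent ∞ (fun z ↦ (Bundle.TotalSpace.mk' (EuclideanSpace ℝ (Fin 4)) (bC.incl z) (νC z) :
TangentBundle (𝓡∂ 4) C)) ∧ (∀ z, (show EuclideanSpace ℝ (Fin 4) from νC z) 0 < 0)) ∧
(gW.IsRiemannian ∧ (∀ x, 0 < gW.scalarCurvature x) ∧ gW.IsUnitNormal (𝓡 3) bW.incl νW 1 ∧ ContMDiff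
(𝓡 3) (𝓡∂ 4).tangent ∞ (fun w ↦ (Bundle.TotalSpace.mk' (EuclideanSpace ℝ (Fin 4)) (bW.incl w) (νW w)
: TangentBundle (𝓡∂ 4) W)) ∧ (∀ w, (show EuclideanSpace ℝ (Fin 4) from νW w) 0 < 0)) ∧ (∀ z,
Literature.Geometry.Lorentzian.pullbackBilin (I := 𝓡∂ 4) (I' := 𝓡 3) bC.incl gC.val z =
Literature.Geometry.Lorentzian.pullbackBilin (I := 𝓡∂ 4) (I' := 𝓡 3) (bW.incl ∘ φ ∘ τ) gW.val z) ∧ ∀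
z, 0 ≤ gC.meanCurvature bC.incl
Literature.Geometry.Lorentzian.PseudoRiemannianMetric.contMDiff_pullbackBilin_holds hfC νC z +
gW.meanCurvature bW.incl
Literature.Geometry.Lorentzian.PseudoRiemannianMetric.contMDiff_pullbackBilin_holds hfW νW (φ (τ
z))`

## Assembly
Bookkeeping, PROVED sorry-free in the planner's SketchProofs.lean (theorem `assembly_holds`, axioms
propext / Classical.choice /
Quot.sound; file attached as evidence) modulo two NAMED FACTS taken as inline hypotheses (cite items
filed): (F1) CORK
PRESENTATION WITH COMPACT SMOOTH EXTERIOR — every homotopy 4-sphere S is C ∪_{τ.trans φ} W where S⁴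
= C ∪_φ W, C compact
contractible, W compact, both Hausdorff second-countable smooth 4-manifolds with boundary
(KervaireMilnorAnnals1963 Θ₄ = 0 ⊕
CurtisFreedmanHsiangStong1996 / Matveyev1996; the tree's `corkDecomposition` states this with a bare
exterior W — no
T2/second-countable/IsManifold/compact — which cannot carry a metric, hence the inline form); (F2)
BÄR–HANKE GLUING in
relational form — if P is a boundary gluing M ∪_ψ N of compact pieces (IsBoundaryGluing bM bN ψ (𝓡
4) P) and the pieces carry
Riemannian PSC metrics with equal boundary forms under ψ and H_M + H_N∘ψ ≥ 0 (outward normals), then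
P carries a Riemannian
PSC metric (BarHanke2023 §4.4 Thm 42/4.11, after Miao2002; P's smooth structure near the seam is the
glued one by
`nonempty_diffeomorph_of_isBoundaryGluing`). Proof: given S, (F1) yields the pieces and both
gluings; TwistedFillIn applied to
the S⁴-gluing yields the compatible pair along φ∘τ = ⇑(τ.trans φ) (definitional); (F2) applied to
the S-gluing yields PSC on
S.carrier, i.e. PscAllHomotopySpheres S.

Rationale: WHY THIS LINE. Scalar-curvature obstructions are blind on a homotopy 4-sphere Σ (σ = 0, b⁺ = 0:
Lichnerowicz/SW/enlargeability silent;
KumarSen2025) but NOT near the boundary Y of a cork: Y = ∂C is a homology 3-sphere ≠ S³ and the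
fill-in theory of
Gromov2023/ShiWangWei2022/Miao2021 and the boundary deformation theory of BarHanke2023/BarHanke2021
are quantitative exactly
there; the cork theorem moves the whole problem onto the two honest pieces of S⁴ (imported:
scalar-curvature-with-boundary
geometry — Bartnik data, fill-ins, corner smoothing — plus cork theory; no spectral/probabilistic
reformulation). Planning
corrected the card twice against the literature read this session: (i) its NEVER-MEAN-CONVEX claim
(§3a: "cork boundaries
are never mean-convex in PSC S⁴", "exotic reflections of S⁴ = D(C) admit no invariant PSC metric")
is FALSE — product
collars are not among Bär–Hanke's equivalent boundary conditions (BarHanke2023 Rem. 41, example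
D²×T^{n−2}), and by
LawsonMichelsohn1984 (Sweeney2026 Prop. 1.2) every Mazur cork — Akbulut's included — carries
constant-curvature-1 metrics
with mean-convex boundary, hence (BarHanke2023 Cor. 34) PSC doubling metrics invariant under the
exotic reflection; (ii) its
FLEX-h crux is ShiWangWei2022 Thm 1.1 (support here). What survives is sharper: since the round
metric shows that the Bartnik
data (h⁰, H⁰) of the cork boundary are PSC-fillable by (C, incl), the cork side of X asks whether
they are still fillable by
(C, incl∘τ) — the SAME data on a filling that differs only by the exotic rel-boundary structure —
i.e. whether PSC fill-in
regions of contractible 4-manifolds are invariant under non-extendable boundary diffeomorphisms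
(crux 2; trivially yes when
τ extends to a diffeomorphism). Invariance ⇒ PSC-ALL (glue proved); failure = Bartnik fill-in data
detecting a cork, a
scalar-curvature detection of 4-dimensional exotica that no prior route or the (empty) negatives
index records; nearest
prior route WeylBudget asks for ONE PSC metric on S⁴ with τ-symmetric data (its CorkRegluablePsc =
the diagonal special case
of X) inside a Weyl-energy programme.

RANKED CRUXES. #0 TwistedFillIn (target) — X (card §2 in (h,H)-form): for all compact contractible C
and compact W (smooth 4-manifolds with boundary data bC, bW), every φ : ∂C ≃ ∂W with
IsBoundaryGluing bC bW φ S⁴ (the pieces of a splitting of the standard 4-sphere) and every τ : ∂C ≃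
∂C, there are Riemannian PSC metrics g_C, g_W (with Levi-Civita connection), smooth OUTWARD unit
normals ν_C, ν_W along the boundary inclusions (outward = negative first half-space coordinate in
the boundary chart, Mathlib EuclideanHalfSpace 4 = {0 ≤ x 0}), with equal induced boundary forms
incl_C^* g_C = (incl_W ∘ φ ∘ τ)^* g_W and 0 ≤ H_C(z) + H_W(φ(τ z)) for all z (H = tree
meanCurvature, trace of K_ν for the outward ν). [difficulty: open-problem] (why it might fail: ⇔ PSC
on every homotopy 4-sphere (open, KumarSen2025 Obs. 9): false iff some cork twist of S⁴ lacks PSC;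
the mean-convex end of each fill-in region is obstructed (Miao2021, ShiWangWei2022 Thm 1.2) and τ
may carry the region where C must be convex onto one where W must be.) [KumarSen2025, BarHanke2023,
ShiWangWei2022, Miao2021, CurtisFreedmanHsiangStong1996, Matveyev1996, KervaireMilnorAnnals1963]
#2 CorkFillInInvariance (crux) — FILL-IN REGIONS DO NOT SEE THE TWIST: for every compact
contractible smooth 4-manifold C with boundary datum bC and every self-diffeomorphism τ of ∂C, if
(h, H) are the boundary metric and outward mean curvature of some PSC metric g on C, then (τ^*h,
H∘τ) is again PSC-fillable by C: there is a PSC metric g' with incl^*g' = (incl∘τ)^*g and H_{g'}(z)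
≥ H_g(τ z). Trivial when τ extends to a diffeomorphism F (take F^*g); for a cork it says the PSC
fill-in region ℱ(C) ⊂ Met(∂C) × C^∞(∂C) is blind to the exotic rel-boundary smooth structure. With
RestrictionToPieces and the round metric it gives CorkSideFillIn (glue InvarianceGivesCorkSide,
proved). [difficulty: open-problem] (why it might fail: For a genuine cork τ extends to no
diffeomorphism (Akbulut1991Fake); near-rigid data — thin mean-convex tubes N_ε(K) ⊂ round S⁴ with H
~ 1/ε at the obstructed end (Miao2021) — may admit essentially one NNSC fill-in (Shi–Tam/Brown–York
rigidity), which τ would have to transport.) [BarHanke2023, ShiWangWei2022, Miao2021, Gromov2023,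
Akbulut1991Fake, AkbulutRuberman2016,
Literature.Barriers.SmoothPoincare4.RelativeContractibleBarrierFour]
#3 CorkSideFillIn (crux) — THE CORK ABSORBS THE TWIST (existential, one-sided form of X): for the
pieces (C, W, φ) of a splitting of S⁴ and any τ, there exist a φ-compatible PSC pair (g₀ on C, g_W
on W: equal boundary forms under φ, H_{g₀} + H_W∘φ ≥ 0 — e.g. the restrictions of ANY PSC metric on
S⁴) and a PSC metric g' on C with incl^*g' = (incl∘τ)^*g₀ and H_{g'} ≥ H_{g₀}∘τ. Then (g', g_W) is a
compatible pair for the twisted gluing, so CorkSideFillIn → TwistedFillIn (glue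
CorkSideGivesTwisted, proved). The freedom over CorkFillInInvariance: the PSC metric on S⁴ may be
CHOSEN adapted to τ (e.g. nearly τ-symmetric near Y; WeylBudget's CorkRegluablePsc is the
exactly-symmetric extreme). [deps: CorkFillInInvariance] [difficulty: open-problem] (why it might
fail: Forces the cork side to absorb the whole twist against a frozen exterior; even if X holds both
pieces may have to move, and every choice of g₀ may sit in a regime where (incl∘τ)-fill-ins of its
data are obstructed (large H where τ lands thin parts of Y).) [BarHanke2023, BarHanke2021,
LawsonMichelsohn1984, ShiWangWei2022, AkbulutMatveyev1998, Matveyev1996]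
#4 MeanConvexTwistedPair (crux) — MEAN-CONVEX ON BOTH SIDES (sign conditions per piece + metric
matching, no comparison of mean-curvature functions across τ): for the pieces (C, W, φ) of a
splitting of S⁴ and any τ there are PSC metrics g_C on C and g_W on W, BOTH with mean-convex
boundary (H ≥ 0 for the outward normal), with incl_C^*g_C = (incl_W∘φ∘τ)^*g_W. Then H_C + H_W∘φτ ≥ 0
trivially, so → TwistedFillIn (glue proved). Each Mazur piece separately carries mean-convex PSC
(even K ≡ 1) metrics by LawsonMichelsohn1984 / Sweeney2026 Prop 1.2 (this REFUTES the card's §3a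
rigidity claim); the content is matching the boundary metrics inside the two mean-convex-fillable
cones 𝓜(C), (φτ)^*𝓜(W) ⊂ Met(Y). [difficulty: XL] (why it might fail: Mean-convexity is the
obstructed end of the fill-in region (Miao2021; RosenbergRubermanXu2026 for ξ-type obstructions with
Yamabe-positive boundary classes): the cones 𝓜(C) and (φτ)^*𝓜(W) need not meet — unclear already for
τ = id (round S⁴ makes C convex and W concave).) [LawsonMichelsohn1984, Sweeney2026, BarHanke2023,
Miao2021, RosenbergRubermanXu2026, Mazur1961]
#9 RestrictionToPieces (support) — RESTRICTION (converse of the gluing fact; also the kill-direction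
engine): if P is a boundary gluing M ∪_ψ N of compact smooth 4-manifolds with boundary
(IsBoundaryGluing bM bN ψ (𝓡 4) P) and g is a Riemannian PSC metric on P, then the pieces carry
Riemannian PSC metrics (the pullbacks along the hidden piece embeddings,
`PseudoRiemannianMetric.comap`) with smooth outward unit normals, equal boundary forms under ψ and
H_M(z) + H_N(ψ z) = 0. Proof: comap along jM, jN (injective differentials, equal dimension),
naturality of Levi-Civita/scalar curvature/second fundamental form under isometric embeddings, and
ν_M^out ↦ −ν_N^out on the common hypersurface. [difficulty: L] [ONeill1983, BarHanke2023,
Literature.Geometry.Lorentzian.PseudoRiemannianMetric.comap]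
#9 FlexBoundaryMetric (support) — FLEX-h (card K2, KNOWN): on a compact smooth 4-manifold with
boundary admitting some PSC metric (automatic when the boundary is nonempty, Gromov's h-principle),
every Riemannian metric h on the boundary is the induced boundary form of a Riemannian PSC metric:
ShiWangWei2022 Thm 1.1 (answering Gromov's Question, Four Lectures pp. 31–32); moreover any mean
curvature H ≤ C(X, h) can be prescribed (loc. cit., remark after Thm 1.1). Vendoring target for the
Literature programme; provable from a PSC-cobordism collar (SWW Lemma 2.x, quasi-spherical
equation). [difficulty: L] [ShiWangWei2022, Gromov2023, BarHanke2023]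
#9 CorkSideGivesTwisted (support) — GLUE (pure logic + chain rule for pullbacks, PROVED sorry-free
in the planner's SketchProofs.lean, theorem corkSideGivesTwisted_holds): CorkSideFillIn →
TwistedFillIn — pair g' with g_W; boundary forms: incl^*g' = τ^*(incl^*g₀) = τ^*φ^*(incl_W^*g_W) via
`pullbackBilin_comp`; mean curvature: H_{g'}(z) + H_W(φτz) ≥ H_{g₀}(τz) + H_W(φ(τz)) ≥ 0. [deps:
CorkSideFillIn, TwistedFillIn] [difficulty: provable-now] [BarHanke2023,
Literature.Geometry.Lorentzian.pullbackBilin_comp]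
#9 MeanConvexPairGivesTwisted (support) — GLUE (PROVED sorry-free in SketchProofs.lean,
meanConvexPairGivesTwisted_holds): MeanConvexTwistedPair → TwistedFillIn (add the two sign
conditions). [deps: MeanConvexTwistedPair, TwistedFillIn] [difficulty: provable-now] [BarHanke2023]
#9 InvarianceGivesCorkSide (support) — GLUE (PROVED sorry-free in SketchProofs.lean,
invarianceGivesCorkSide_holds): (S⁴ carries a Riemannian PSC metric — the round one, Literature
`roundMetric` + `ricci_roundMetric`) → RestrictionToPieces → CorkFillInInvariance → CorkSideFillIn:
restrict the PSC metric of S⁴ to the φ-compatible pair (g₀, g_W) (sum of mean curvatures = 0) and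
apply invariance to g₀. [deps: RestrictionToPieces, CorkFillInInvariance, CorkSideFillIn]
[difficulty: provable-now] [BarHanke2023, Literature.Geometry.Riemannian.ricci_roundMetric]
#9 PscAllHomotopySpheres (support) — THE WALL (not to be attacked inside this route): every homotopy
4-sphere carries a Riemannian metric of positive scalar curvature — verbatim the signature of route
PIC's crux PicPscV2 (shared ledger item stmt-SmoothPoincare4-0442), so that closing it there or here
is the same event; it is the conclusion of this route's Assembly. [deps: TwistedFillIn] [difficulty:
open-problem] [KumarSen2025, Hamilton1997,
Summit.SmoothPoincare4.SmoothPoincare4.Theses.PIC.PicPscV2]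

TWO-LAYER PLAN. Foreseen glued splits (none filed now; k ≤ 3, depth 1). CorkFillInInvariance ⇐
(InvarianceBelowThreshold: τ-invariance of
ℱ(C) restricted to data with H ≤ C(h) — expected provable from ShiWangWei2022 §2 collars,
fillability there being
τ-independent) → (EnvelopeInvariance: τ-invariance of the upper envelope of ℱ(C) at each h) →
CorkFillInInvariance.
CorkSideFillIn ⇐ (AdaptedSpherePsc: a PSC metric on S⁴ whose Bartnik data on Y are τ-invariant up to
δ in C^k — WeylBudget's
CorkRegluablePsc is δ = 0) → (FillInStability: PSC-fillability by C is open under C^k-small changes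
of (h, H) — BarHanke2021
local flexibility + BarHanke2023 Thm 27) → CorkSideFillIn. MeanConvexTwistedPair ⇐ (MeanConvexCone:
description of
𝓜(C) ⊂ Met(Y) for a Mazur cork, starting from LawsonMichelsohn1984 thin tubes) → (ConeMatching
across φτ) →
MeanConvexTwistedPair. The glue items CorkSideGivesTwisted / MeanConvexPairGivesTwisted /
InvarianceGivesCorkSide and the
Assembly are already proved in the sketch (attach on open).

KILL CRITERIA. - TwistedFillIn REFUTED (a splitting S⁴ = C ∪_φ W and a τ with NO compatible PSC
pair): by RestrictionToPieces and gluing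
  existence/uniqueness (`exists_isBoundaryGluing`, `nonempty_diffeomorph_of_isBoundaryGluing`) the
regluing C ∪_{φτ} W — a
  simply connected homology 4-sphere, hence a homotopy 4-sphere — carries no PSC metric:
PIC.PicPscV2 is refuted and, since
  SPC4 would make it diffeomorphic to the round S⁴, so is SmoothPoincare4. Close `--reason
refuted:TwistedFillIn` and file the
  ¬SPC4 consequence with the tenure planner; the route dies together with the positive side of the
problem.
- CorkFillInInvariance refuted (Bartnik data that C fills along incl but not along incl∘τ): NOT a
kill — drop/restate crux 2,
  keep CorkSideFillIn (adapted pairs); the refutation is itself a result (scalar curvature detects a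
cork) worth a Theorems file.
- MeanConvexTwistedPair refuted: drop crux 4 (not load-bearing for the Assembly).
- PscAllHomotopySpheres proved elsewhere (PIC crux 3, WeylBudget's CorkRegluablePsc): route
superseded, close `--reason superseded`.
- A proof that (F2) fails in the relational form used (seam regularity): pivot the Assembly
hypothesis to explicit piece
  embeddings; nothing else changes.

NOT DECOMPOSED YET. - The structure of ℱ(C) for a concrete cork (Akbulut–Mazur C = N(K) ⊂ S⁴ =
D(C)): envelopes, the thin-tube regime, band-width
  shortness of PSC collars over the aspherical Y (Gromov 2018; Zhu, Cecchini–Zeidler in dim ≤ 7: 2L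
≤ 2π√(3/(4σ)) for
  scal ≥ σ) — layer-2 children of cruxes 2–3 once one closes or stalls.
- The card's Neumann–Yamabe (Rayleigh-bracketing) weakening and Escobar's boundary Yamabe problem —
needs H¹/conformal-Laplacian
  vocabulary on compact pieces; not needed for X ⇔ PSC-ALL.
- The involution/Stein refinement of the cork theorem (AkbulutMatveyev1998) — statements quantify
over all τ, so not needed.
- The card's negative μ-bubble "forced-sign region" format (§5): as stated it is void (ℱ is downward
closed in H, BarHanke2023
  Rem. 37, so no region is forced POSITIVE for fixed h); a correct negative certificate must bound
the ENVELOPE of ℱ(C) from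
  above on τ(F) and that of ℱ^φ(W) on F — to be typed only against a concrete cork and metric.
- A formal kill item ¬TwistedFillIn → ¬SmoothPoincare4 (needs 'regluings of contractible pieces of
S⁴ are homotopy spheres'
  and PSC transport along diffeomorphisms) — filed by the tenure planner if crux work turns
negative.

CHEAPEST FALSIFIER. Already run this session (lookups): (a) BarHanke2023 Rem. 41 +
LawsonMichelsohn1984 / Sweeney2026 Prop. 1.2 FALSIFY the card's
§3(a) NEVER-MEAN-CONVEX and "exotic reflections repel PSC" claims (Mazur corks carry K ≡ 1 metrics
with mean-convex
boundary; doubling gives reflection-invariant PSC on D(C) = S⁴) — the route was re-planned around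
this, nothing filed rests
on §3(a); (b) ShiWangWei2022 Thm 1.1 settles FLEX-h (support, not crux). Cheapest remaining check,
aimed at crux 2: take the
Akbulut cork thin, C = N_ε(K) ⊂ round S⁴ = D(C), Bartnik data (h⁰, H⁰ ≈ const/ε > 0 mean-convex);
decide whether
(Y, h⁰, H⁰) re-attached along incl∘τ admits ANY NNSC fill-in by C — a Brown–York / Shi–Tam-type mass
of the τ-transported
data (isometric embedding of the thin tube pieces into ℝ⁴ where available) going negative is a
one-page certificate refuting
CorkFillInInvariance (the route survives on crux 3); a positive answer in this most rigid regime is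
strong evidence for X.

NUMBERS. - Sign conventions: Bär–Hanke H_BH = (1/(n−1)) tr W for the interior normal with II = −½
ġ_t (unit ball: +1) = (1/3) × the
  tree's `meanCurvature` for the OUTWARD unit normal (unit ball of ℝ⁴: +3; K_ν(v,w) = +g(∇_v ν, w),
Hypersurface.lean); ShiWangWei2022
  fill-ins use the outward normal too. Gluing condition H₁ + H₂ ≥ 0 is scale-free.
- Fill-in region: downward closed in H at fixed h (BarHanke2023 Thm 36 / Rem. 37); every h occurs
and every H ≤ C(X, h) occurs
  (ShiWangWei2022 Thm 1.1 + remark); no NNSC fill-in with H > h₀(Σ, γ) pointwise (ShiWangWei2022 Thm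
1.2 for Σ ↪ ℝⁿ⁺¹,
  2 ≤ n ≤ 6; Miao2021 for all Σ).
- Band width over the aspherical cork boundary: a PSC region Y × [−L, L] with scal ≥ σ has 2L ≤
2π√(3/(4σ)) (Gromov 2018;
  μ-bubbles, dim 4 fine).
- Mean-convex PSC on Mazur corks: exists, even K ≡ 1 (LawsonMichelsohn1984 via Sweeney2026 Prop.
1.2); PSC with convex
  boundary too (BarHanke2023 applied there).

DEFINITION REQUESTS. - None blocking: every item is typed over existing declarations (BoundaryData,
IsBoundaryGluing, PseudoRiemannianMetric,
  scalarCurvature, IsSpacelikeImmersion, IsUnitNormal, meanCurvature, pullbackBilin,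
contMDiff_pullbackBilin_holds,
  HomotopySphere) and elaborates (planner Sketch.lean rc 0, 2026-08-15).
- Nice-to-have (to shorten the 2–3 kchar statements): a packaged predicate `PscFillIn bP g ν`
(Riemannian PSC metric on a
  compact 4-manifold with boundary + smooth outward unit normal along bP.incl) and `bartnikData bP g
ν = (incl^*g, H)` —
  topic Summits/SmoothPoincare4/SmoothPoincare4/Theorems (support-level; not filed as a definition
item).
- Cite facts wanted (filed as cite workitems after open): (F1) cork presentation of homotopy
4-spheres with compact smooth
  Hausdorff second-countable exterior (KervaireMilnorAnnals1963 +
CurtisFreedmanHsiangStong1996/Matveyev1996); (F2)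
  BarHanke2023 §4.4 Thm 42 (= 4.11) smoothing of mean-convex singularities in the relational
IsBoundaryGluing form;
  (F3) ShiWangWei2022 Thm 1.1 (= FlexBoundaryMetric); (F4) LawsonMichelsohn1984 main theorem for
domains in S⁴ built from
  handles of index ≤ 2 (mean-convex isotopy), used by crux 4.

Novelty: Searches (2026-08-15): `lit search` default/hybrid — searchd rc 75 twice (off-box service down),
arXiv/OpenAlex/S2 HTTP 429;
`lit search --source zbmath`: "positive scalar curvature cork" (2 hits, none relevant), "scalar
curvature homotopy sphere
four" (6: Sweeney2026 = arXiv:2507.15719 READ pp. 3–4, JoachimWraith2008), "mean convex boundary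
positive scalar curvature"
(12: Gromov2020, ShiTam2002, MantoulidisMiao2017, Bär–Hanke arXiv:2503.16232 READ-grep,
RosenbergRubermanXu2026 =
arXiv:2302.05521 READ-grep, LuMiao2019, Brendle2024), "fill-in nonnegative scalar curvature" (7:
Miao2021, ShiWangWei2022 READ
p. 3, ShiEtAl2020, Jauregui2013, ChenLiuShiZhu2025), "exotic smooth structure positive scalar
curvature four-manifold" (0),
"Gluck twist positive scalar curvature" (0), "equivariant positive scalar curvature involution" (0),
"scalar curvature
fill-in exotic" (0); `lit galaxy search --star all`: "NNSC fill-in" (1: Cecchini–Hirsch–Zeidler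
arXiv:2404.17533), "positive
scalar curvature fill-in" (0), "fill-in of nonnegative scalar curvature" (0), `--star pdf` "cork
twist" (0); full READ of
BarHanke2023 = arXiv:2012.09127 pp. 1–3, 10, 15–17 (Thms 32/33/36/39/42, Cor. 34/40, Rem. 37/41);
ledger: the 24
SmoothPoincare4 route files (nearest WeylBudget, PIC), `ledger negatives` (0), `ledger idea list`
(129 cards; cork-twins-census,
weyl-budget-cork-regluing nearest); `lit frontier/bridges` not available (searchd down) — noted.
Nearest prior art found: route WeylBudget crux CorkRegluabl  [refs: 2507.15719, 2503.16232, 2302.05521, 2404.17533, 2012.09127, Sweeney2026, Gromov2020, RosenbergRubermanXu2026, Miao2021, ShiWangWei2022, ShiEtAl2020, BarHanke2023, LawsonMichelsohn1984, Gromov2023]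

Barriers (technique_class: psc-cork-fillin, bartnik-fill-in, bar-hanke-gluing): - technique_class: psc-cork-fillin, bartnik-fill-in, bar-hanke-gluing
- Literature.Barriers.SmoothPoincare4.RelativeContractibleBarrierFour: applies in spirit to crux 2 —
any argument for CorkFillInInvariance that would equally extend τ smoothly over C is dead (corks
exist, Akbulut1991Fake); the line evades it because invariance asks for ONE new PSC metric per
Bartnik datum, not a diffeomorphism, exactly as many cork twists of S⁴ are diffeomorphic to S⁴
although τ does not extend; the honest bet is that PSC fill-ability is softer than smooth extension
— and if it is not, the failure is the result (Bartnik data detect corks).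
- Literature.Barriers.SmoothPoincare4.ContractibleBarrierFour: absolutely exotic contractible pairs
(AkbulutRuberman2016) are not engaged — the filling C is fixed, only its boundary identification
changes; no diffeomorphism of contractible manifolds is concluded anywhere.
- Literature.Barriers.SmoothPoincare4.GaugeSumBarrierFour / StableBarrierFour /
TopologicalBarrierFour / HCobordismInvariantBarrierFour: "admits PSC" is stable under # with PSC
manifolds and under h-cobordism-invisible moves, so it cannot DETECT an exotic sphere unless it
fails outright; the route uses it only as a necessary target (the wall) and as a refutation format
(failure of X ⇒ ¬SPC4), never as a numerical invariant — consistent with all four.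
- Literature.Barriers.SmoothPoincare4.HCobordismBarrierFour: not used as an engine; Θ₄ = 0 enters
only through the cork presentation (F1);

Novelty grade: new-combination — ROUTE REVIEW (refuter f3b46551, 2026-08-15; route CLOSED-retired 13:51Z by D-0027 §2.1 audit: assembly ends in PscAllHomotopySpheres = PIC's wall (stmt-0383 ≡ 0442 verbatim), necessary but not sufficient for SPC4 — also my structural objection; no conforming re-open possible since PSC-ALL ⇏ SPC4). C (refuter refuter-rreview-route-AtomisticToContinu-f3b46551-0, 2026-08-15T13:57:47Z; prior: BarHanke2023, ShiWangWei2022, Miao2021, CurtisFreedmanHsiangStong1996, Matveyev1996, LawsonMichelsohn1984, Sweeney2026)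

History (route lifecycle, newest last):
- 2026-08-15T13:51:33Z · CLOSED retired — not-a-thesis: assembly does not conclude the sub-problem Statement (operator:999:1257524)

sub-problem: SmoothPoincare4 · status: closed(retired) · opened planner-plancard-SmoothPoincare4-SmoothPoinca-8497055e-0 2026-08-15T12:31:19Z · rev 0 · ledger route-SmoothPoincare4-PscCorkFillIn
GENERATED by the gate from the ledger (D-0016/17). Provers cite these decls: `theorem foo : Summit.SmoothPoincare4.SmoothPoincare4.Theses.PscCorkFillIn.<Decl> := …` in Summits/SmoothPoincare4/SmoothPoincare4/Theorems/<Name>.lean.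
-/

namespace Summit.SmoothPoincare4.SmoothPoincare4.Theses.PscCorkFillIn

open scoped BigOperators Topology Manifold Classical MeasureTheory ProbabilityTheory Matrix InnerProductSpace ComplexConjugate ContinuousMap ContDiff
open Filter Set Function TopologicalSpace MeasureTheory

attribute [summit_statement] _root_.SmoothPoincare4

open Literature.SPC4

/-- item stmt-SmoothPoincare4-8128 · target · rank 0 · closed · moot by None · by planner
why it might fail: ⇔ PSC on every homotopy 4-sphere (open, KumarSen2025 Obs. 9): false iff some cork twist of S⁴ lacks PSC; the mean-convex end of each fill-in region is obstructed (Miao2021, ShiWangWei2022 Thm 1.2) and τ may carry the region where C must be convex onto one where W must be.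
sources: KumarSen2025, BarHanke2023, ShiWangWei2022, Miao2021, CurtisFreedmanHsiangStong1996, Matveyev1996
[target] X (card §2 in (h,H)-form): for all compact contractible C and compact W (smooth 4-manifolds
with boundary data bC, bW), every φ : ∂C ≃ ∂W with IsBoundaryGluing bC bW φ S⁴ (the pieces of a
splitting of the standard 4-sphere) and every τ : ∂C ≃ ∂C, there are Riemannian PSC metrics g_C, g_W
(with Levi-Civita connection), smooth OUTWARD unit normals ν_C, ν_W along the boundary inclusions
(outward = negative first half-space coordinate in the boundary chart, Mathlib EuclideanHalfSpace 4
= {0 ≤ x 0}), with equal induced boundary forms incl_C^* g_C = (incl_W ∘ φ ∘ τ)^* g_W and 0 ≤ H_C(z)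
+ H_W(φ(τ z)) for all z (H = tree meanCurvature, trace of K_ν for the outward ν). [difficulty:
open-problem] -/
@[route_item "route-SmoothPoincare4-PscCorkFillIn"]
def TwistedFillIn : Prop :=
  ∀ (C : Type) [TopologicalSpace C] [T2Space C] [SecondCountableTopology C] [ChartedSpace (EuclideanHalfSpace 4) C] [IsManifold (𝓡∂ 4) ∞ C] [CompactSpace C] [ContractibleSpace C] (bC : Literature.Topology.FourManifolds.BoundaryData (𝓡∂ 4) C (𝓡 3)) (W : Type) [TopologicalSpace W] [T2Space W] [SecondCountableTopology W] [ChartedSpace (EuclideanHalfSpace 4) W] [IsManifold (𝓡∂ 4) ∞ W] [CompactSpace W] (bW : Literature.Topology.FourManifolds.BoundaryData (𝓡∂ 4) W (𝓡 3)) (φ : bC.carrier ≃ₘ⟮𝓡 3, 𝓡 3⟯ bW.carrier) (τ : bC.carrier ≃ₘ⟮𝓡 3, 𝓡 3⟯ bC.carrier), Literature.Topology.FourManifolds.IsBoundaryGluing bC bW φ (𝓡 4) (Metric.sphere (0 : EuclideanSpace ℝ (Fin 5)) 1) → ∃ gC : Literature.Geometry.Lorentzian.PseudoRiemannianMetric (𝓡∂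 4) ∞ (EuclideanSpace ℝ (Fin 4)) (TangentSpace (𝓡∂ 4) : C → Type _), ∃ _ : gC.HasLeviCivita, ∃ hfC : gC.IsSpacelikeImmersion (𝓡 3) bC.incl, ∃ νC : Literature.Geometry.Lorentzian.NormalField (𝓡∂ 4) bC.incl, ∃ gW : Literature.Geometry.Lorentzian.PseudoRiemannianMetric (𝓡∂ 4) ∞ (EuclideanSpace ℝ (Fin 4)) (TangentSpace (𝓡∂ 4) : W → Type _), ∃ _ : gW.HasLeviCivita, ∃ hfW : gW.IsSpacelikeImmersion (𝓡 3) bW.incl, ∃ νW : Literature.Geometry.Lorentzian.NormalField (𝓡∂ 4) bW.incl, (gC.IsRiemannian ∧ (∀ x, 0 < gC.scalarCurvature x) ∧ gC.IsUnitNormal (𝓡 3) bC.incl νC 1 ∧ ContMDiff (𝓡 3) (𝓡∂ 4).tangent ∞ (fun z ↦ (Bundle.TotalSpace.mk' (EuclideanSpace ℝ (Fin 4)) (bC.incl z) (νC z) : TangentBundle (𝓡∂ 4) C)) ∧ (∀ z, (show EuclideanSpace ℝ (Fin 4) from νC z) 0 < 0)) ∧ (gW.IsRiemannian ∧ (∀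 x, 0 < gW.scalarCurvature x) ∧ gW.IsUnitNormal (𝓡 3) bW.incl νW 1 ∧ ContMDiff (𝓡 3) (𝓡∂ 4).tangent ∞ (fun w ↦ (Bundle.TotalSpace.mk' (EuclideanSpace ℝ (Fin 4)) (bW.incl w) (νW w) : TangentBundle (𝓡∂ 4) W)) ∧ (∀ w, (show EuclideanSpace ℝ (Fin 4) from νW w) 0 < 0)) ∧ (∀ z, Literature.Geometry.Lorentzian.pullbackBilin (I := 𝓡∂ 4) (I' := 𝓡 3) bC.incl gC.val z = Literature.Geometry.Lorentzian.pullbackBilin (I := 𝓡∂ 4) (I' := 𝓡 3) (bW.incl ∘ φ ∘ τ) gW.val z) ∧ ∀ z, 0 ≤ gC.meanCurvature bC.incl Literature.Geometry.Lorentzian.PseudoRiemannianMetric.contMDiff_pullbackBilin_holds hfC νC z + gW.meanCurvature bW.incl Literature.Geometry.Lorentzian.PseudoRiemannianMetric.contMDiff_pullbackBilin_holds hfW νW (φ (τ z))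

/-- item stmt-SmoothPoincare4-8129 · crux · rank 2 · closed · moot by None · by planner
why it might fail: For a genuine cork τ extends to no diffeomorphism (Akbulut1991Fake); near-rigid data — thin mean-convex tubes N_ε(K) ⊂ round S⁴ with H ~ 1/ε at the obstructed end (Miao2021) — may admit essentially one NNSC fill-in (Shi–Tam/Brown–York rigidity), which τ would have to transport.
sources: BarHanke2023, ShiWangWei2022, Miao2021, Gromov2023, Akbulut1991Fake, AkbulutRuberman2016
[crux] FILL-IN REGIONS DO NOT SEE THE TWIST: for every compact contractible smooth 4-manifold C with
boundary datum bC and every self-diffeomorphism τ of ∂C, if (h, H) are the boundary metric and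
outward mean curvature of some PSC metric g on C, then (τ^*h, H∘τ) is again PSC-fillable by C: there
is a PSC metric g' with incl^*g' = (incl∘τ)^*g and H_{g'}(z) ≥ H_g(τ z). Trivial when τ extends to a
diffeomorphism F (take F^*g); for a cork it says the PSC fill-in region ℱ(C) ⊂ Met(∂C) × C^∞(∂C) is
blind to the exotic rel-boundary smooth structure. With RestrictionToPieces and the round metric it
gives CorkSideFillIn (glue InvarianceGivesCorkSide, proved). [difficulty: open-problem] -/
@[route_item "route-SmoothPoincare4-PscCorkFillIn"]
def CorkFillInInvariance : Prop :=
  ∀ (C : Type) [TopologicalSpace C] [T2Space C] [SecondCountableTopology C] [ChartedSpace (EuclideanHalfSpace 4) C] [IsManifold (𝓡∂ 4) ∞ C] [CompactSpace C] [ContractibleSpace C] (bC : Literature.Topology.FourManifolds.BoundaryData (𝓡∂ 4) C (𝓡 3)) (τ : bC.carrier ≃ₘ⟮𝓡 3, 𝓡 3⟯ bC.carrier), ∀ (g : Literature.Geometry.Lorentzian.PseudoRiemannianMetric (𝓡∂ 4) ∞ (EuclideanSpace ℝ (Fin 4)) (TangentSpace (𝓡∂ 4) : C → Type _)) [g.HasLeviCivita]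 (hf : g.IsSpacelikeImmersion (𝓡 3) bC.incl) (ν : Literature.Geometry.Lorentzian.NormalField (𝓡∂ 4) bC.incl), g.IsRiemannian → (∀ x, 0 < g.scalarCurvature x) → g.IsUnitNormal (𝓡 3) bC.incl ν 1 → ContMDiff (𝓡 3) (𝓡∂ 4).tangent ∞ (fun z ↦ (Bundle.TotalSpace.mk' (EuclideanSpace ℝ (Fin 4)) (bC.incl z) (ν z) : TangentBundle (𝓡∂ 4) C)) → (∀ z, (show EuclideanSpace ℝ (Fin 4) from ν z) 0 < 0) → ∃ g' : Literature.Geometry.Lorentzian.PseudoRiemannianMetric (𝓡∂ 4) ∞ (EuclideanSpace ℝ (Fin 4)) (TangentSpace (𝓡∂ 4) : C → Type _), ∃ _ : g'.HasLeviCivita, ∃ hf' : g'.IsSpacelikeImmersion (𝓡 3) bC.incl, ∃ ν' : Literature.Geometry.Lorentzian.NormalField (𝓡∂ 4) bC.incl, (g'.IsRiemannian ∧ (∀ x, 0 < g'.scalarCurvature x) ∧ g'.IsUnitNormal (𝓡 3) bC.incl ν' 1 ∧ ContMDiff (𝓡 3) (𝓡∂ 4).tangent ∞ (fun z ↦ (Bundle.TotalSpace.mk'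 (EuclideanSpace ℝ (Fin 4)) (bC.incl z) (ν' z) : TangentBundle (𝓡∂ 4) C)) ∧ (∀ z, (show EuclideanSpace ℝ (Fin 4) from ν' z) 0 < 0)) ∧ (∀ z, Literature.Geometry.Lorentzian.pullbackBilin (I := 𝓡∂ 4) (I' := 𝓡 3) bC.incl g'.val z = Literature.Geometry.Lorentzian.pullbackBilin (I := 𝓡∂ 4) (I' := 𝓡 3) (bC.incl ∘ τ) g.val z) ∧ ∀ z, g.meanCurvature bC.incl Literature.Geometry.Lorentzian.PseudoRiemannianMetric.contMDiff_pullbackBilin_holds hf ν (τ z) ≤ g'.meanCurvature bC.incl Literature.Geometry.Lorentzian.PseudoRiemannianMetric.contMDiff_pullbackBilin_holds hf' ν' z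

/-- item stmt-SmoothPoincare4-8130 · crux · rank 3 · closed · moot by None · by planner
why it might fail: Forces the cork side to absorb the whole twist against a frozen exterior; even if X holds both pieces may have to move, and every choice of g₀ may sit in a regime where (incl∘τ)-fill-ins of its data are obstructed (large H where τ lands thin parts of Y).
sources: BarHanke2023, BarHanke2021, LawsonMichelsohn1984, ShiWangWei2022, AkbulutMatveyev1998, Matveyev1996
[crux] THE CORK ABSORBS THE TWIST (existential, one-sided form of X): for the pieces (C, W, φ) of a
splitting of S⁴ and any τ, there exist a φ-compatible PSC pair (g₀ on C, g_W on W: equal boundary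
forms under φ, H_{g₀} + H_W∘φ ≥ 0 — e.g. the restrictions of ANY PSC metric on S⁴) and a PSC metric
g' on C with incl^*g' = (incl∘τ)^*g₀ and H_{g'} ≥ H_{g₀}∘τ. Then (g', g_W) is a compatible pair for
the twisted gluing, so CorkSideFillIn → TwistedFillIn (glue CorkSideGivesTwisted, proved). The
freedom over CorkFillInInvariance: the PSC metric on S⁴ may be CHOSEN adapted to τ (e.g. nearly
τ-symmetric near Y; WeylBudget's CorkRegluablePsc is the exactly-symmetric extreme). [deps:
CorkFillInInvariance] [difficulty: open-problem] -/
@[route_item "route-SmoothPoincare4-PscCorkFillIn"]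
def CorkSideFillIn : Prop :=
  ∀ (C : Type) [TopologicalSpace C] [T2Space C] [SecondCountableTopology C] [ChartedSpace (EuclideanHalfSpace 4) C] [IsManifold (𝓡∂ 4) ∞ C] [CompactSpace C] [ContractibleSpace C] (bC : Literature.Topology.FourManifolds.BoundaryData (𝓡∂ 4) C (𝓡 3)) (W : Type) [TopologicalSpace W] [T2Space W] [SecondCountableTopology W] [ChartedSpace (EuclideanHalfSpace 4) W] [IsManifold (𝓡∂ 4) ∞ W] [CompactSpace W] (bW : Literature.Topology.FourManifolds.BoundaryData (𝓡∂ 4) W (𝓡 3)) (φ : bC.carrier ≃ₘ⟮𝓡 3, 𝓡 3⟯ bW.carrier) (τ : bC.carrier ≃ₘ⟮𝓡 3, 𝓡 3⟯ bC.carrier), Literature.Topology.FourManifolds.IsBoundaryGluing bC bW φ (𝓡 4) (Metric.sphere (0 : EuclideanSpace ℝ (Fin 5)) 1) → ∃ g₀ : Literature.Geometry.Lorentzian.PseudoRiemannianMetric (𝓡∂ 4) ∞ (EuclideanSpace ℝ (Fin 4)) (TangentSpace (𝓡∂ 4) : C → Type _), ∃ _ : g₀.HasLeviCivita, ∃ hf₀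 : g₀.IsSpacelikeImmersion (𝓡 3) bC.incl, ∃ ν₀ : Literature.Geometry.Lorentzian.NormalField (𝓡∂ 4) bC.incl, ∃ gW : Literature.Geometry.Lorentzian.PseudoRiemannianMetric (𝓡∂ 4) ∞ (EuclideanSpace ℝ (Fin 4)) (TangentSpace (𝓡∂ 4) : W → Type _), ∃ _ : gW.HasLeviCivita, ∃ hfW : gW.IsSpacelikeImmersion (𝓡 3) bW.incl, ∃ νW : Literature.Geometry.Lorentzian.NormalField (𝓡∂ 4) bW.incl, ∃ g' : Literature.Geometry.Lorentzian.PseudoRiemannianMetric (𝓡∂ 4) ∞ (EuclideanSpace ℝ (Fin 4)) (TangentSpace (𝓡∂ 4) : C → Type _), ∃ _ : g'.HasLeviCivita, ∃ hf' : g'.IsSpacelikeImmersion (𝓡 3) bC.incl, ∃ ν' : Literature.Geometry.Lorentzian.NormalField (𝓡∂ 4) bC.incl, (g₀.IsRiemannian ∧ (∀ x, 0 < g₀.scalarCurvature x) ∧ g₀.IsUnitNormal (𝓡 3) bC.incl ν₀ 1 ∧ ContMDiff (𝓡 3) (𝓡∂ 4).tangent ∞ (fun z ↦ (Bundle.TotalSpace.mk'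 (EuclideanSpace ℝ (Fin 4)) (bC.incl z) (ν₀ z) : TangentBundle (𝓡∂ 4) C)) ∧ (∀ z, (show EuclideanSpace ℝ (Fin 4) from ν₀ z) 0 < 0)) ∧ (gW.IsRiemannian ∧ (∀ x, 0 < gW.scalarCurvature x) ∧ gW.IsUnitNormal (𝓡 3) bW.incl νW 1 ∧ ContMDiff (𝓡 3) (𝓡∂ 4).tangent ∞ (fun w ↦ (Bundle.TotalSpace.mk' (EuclideanSpace ℝ (Fin 4)) (bW.incl w) (νW w) : TangentBundle (𝓡∂ 4) W)) ∧ (∀ w, (show EuclideanSpace ℝ (Fin 4) from νW w) 0 < 0)) ∧ (g'.IsRiemannian ∧ (∀ x, 0 < g'.scalarCurvature x) ∧ g'.IsUnitNormal (𝓡 3) bC.incl ν' 1 ∧ ContMDiff (𝓡 3) (𝓡∂ 4).tangent ∞ (fun z ↦ (Bundle.TotalSpace.mk' (EuclideanSpace ℝ (Fin 4)) (bC.incl z) (ν' z) : TangentBundle (𝓡∂ 4) C)) ∧ (∀ z, (show EuclideanSpace ℝ (Fin 4) from ν' z) 0 < 0)) ∧ (∀ z, Literature.Geometry.Lorentzian.pullbackBilin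 (I := 𝓡∂ 4) (I' := 𝓡 3) bC.incl g₀.val z = Literature.Geometry.Lorentzian.pullbackBilin (I := 𝓡∂ 4) (I' := 𝓡 3) (bW.incl ∘ φ) gW.val z) ∧ (∀ z, 0 ≤ g₀.meanCurvature bC.incl Literature.Geometry.Lorentzian.PseudoRiemannianMetric.contMDiff_pullbackBilin_holds hf₀ ν₀ z + gW.meanCurvature bW.incl Literature.Geometry.Lorentzian.PseudoRiemannianMetric.contMDiff_pullbackBilin_holds hfW νW (φ z)) ∧ (∀ z, Literature.Geometry.Lorentzian.pullbackBilin (I := 𝓡∂ 4) (I' := 𝓡 3) bC.incl g'.val z = Literature.Geometry.Lorentzian.pullbackBilin (I := 𝓡∂ 4) (I' := 𝓡 3) (bC.incl ∘ τ) g₀.val z) ∧ ∀ z, g₀.meanCurvature bC.incl Literature.Geometry.Lorentzian.PseudoRiemannianMetric.contMDiff_pullbackBilin_holds hf₀ ν₀ (τ z) ≤ g'.meanCurvature bC.incl Literature.Geometry.Lorentzian.PseudoRiemannianMetric.contMDiff_pullbackBilin_holds hf' ν' z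

/-- item stmt-SmoothPoincare4-8131 · crux · rank 4 · closed · moot by None · by planner
why it might fail: Mean-convexity is the obstructed end of the fill-in region (Miao2021; RosenbergRubermanXu2026 for ξ-type obstructions with Yamabe-positive boundary classes): the cones 𝓜(C) and (φτ)^*𝓜(W) need not meet — unclear already for τ = id (round S⁴ makes C convex and W concave).
sources: LawsonMichelsohn1984, Sweeney2026, BarHanke2023, Miao2021, RosenbergRubermanXu2026, Mazur1961
[crux] MEAN-CONVEX ON BOTH SIDES (sign conditions per piece + metric matching, no comparison of
mean-curvature functions across τ): for the pieces (C, W, φ) of a splitting of S⁴ and any τ there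
are PSC metrics g_C on C and g_W on W, BOTH with mean-convex boundary (H ≥ 0 for the outward
normal), with incl_C^*g_C = (incl_W∘φ∘τ)^*g_W. Then H_C + H_W∘φτ ≥ 0 trivially, so → TwistedFillIn
(glue proved). Each Mazur piece separately carries mean-convex PSC (even K ≡ 1) metrics by
LawsonMichelsohn1984 / Sweeney2026 Prop 1.2 (this REFUTES the card's §3a rigidity claim); the
content is matching the boundary metrics inside the two mean-convex-fillable cones 𝓜(C), (φτ)^*𝓜(W)
⊂ Met(Y). [difficulty: XL] -/
@[route_item "route-SmoothPoincare4-PscCorkFillIn"]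
def MeanConvexTwistedPair : Prop :=
  ∀ (C : Type) [TopologicalSpace C] [T2Space C] [SecondCountableTopology C] [ChartedSpace (EuclideanHalfSpace 4) C] [IsManifold (𝓡∂ 4) ∞ C] [CompactSpace C] [ContractibleSpace C] (bC : Literature.Topology.FourManifolds.BoundaryData (𝓡∂ 4) C (𝓡 3)) (W : Type) [TopologicalSpace W] [T2Space W] [SecondCountableTopology W] [ChartedSpace (EuclideanHalfSpace 4) W] [IsManifold (𝓡∂ 4) ∞ W] [CompactSpace W] (bW : Literature.Topology.FourManifolds.BoundaryData (𝓡∂ 4) W (𝓡 3)) (φ : bC.carrier ≃ₘ⟮𝓡 3, 𝓡 3⟯ bW.carrier) (τ : bC.carrier ≃ₘ⟮𝓡 3, 𝓡 3⟯ bC.carrier), Literature.Topology.FourManifolds.IsBoundaryGluing bC bW φ (𝓡 4) (Metric.sphere (0 : EuclideanSpace ℝ (Fin 5)) 1) → ∃ gC : Literature.Geometry.Lorentzian.PseudoRiemannianMetric (𝓡∂ 4) ∞ (EuclideanSpace ℝ (Fin 4)) (TangentSpace (𝓡∂ 4) : C → Type _), ∃ _ : gC.HasLeviCivita, ∃ hfC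 : gC.IsSpacelikeImmersion (𝓡 3) bC.incl, ∃ νC : Literature.Geometry.Lorentzian.NormalField (𝓡∂ 4) bC.incl, ∃ gW : Literature.Geometry.Lorentzian.PseudoRiemannianMetric (𝓡∂ 4) ∞ (EuclideanSpace ℝ (Fin 4)) (TangentSpace (𝓡∂ 4) : W → Type _), ∃ _ : gW.HasLeviCivita, ∃ hfW : gW.IsSpacelikeImmersion (𝓡 3) bW.incl, ∃ νW : Literature.Geometry.Lorentzian.NormalField (𝓡∂ 4) bW.incl, (gC.IsRiemannian ∧ (∀ x, 0 < gC.scalarCurvature x) ∧ gC.IsUnitNormal (𝓡 3) bC.incl νC 1 ∧ ContMDiff (𝓡 3) (𝓡∂ 4).tangent ∞ (fun z ↦ (Bundle.TotalSpace.mk' (EuclideanSpace ℝ (Fin 4)) (bC.incl z) (νC z) : TangentBundle (𝓡∂ 4) C)) ∧ (∀ z, (show EuclideanSpace ℝ (Fin 4) from νC z) 0 < 0)) ∧ (gW.IsRiemannian ∧ (∀ x, 0 < gW.scalarCurvature x) ∧ gW.IsUnitNormal (𝓡 3) bW.incl νW 1 ∧ ContMDiff (𝓡 3) (𝓡∂ 4).tangent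 ∞ (fun w ↦ (Bundle.TotalSpace.mk' (EuclideanSpace ℝ (Fin 4)) (bW.incl w) (νW w) : TangentBundle (𝓡∂ 4) W)) ∧ (∀ w, (show EuclideanSpace ℝ (Fin 4) from νW w) 0 < 0)) ∧ (∀ z, Literature.Geometry.Lorentzian.pullbackBilin (I := 𝓡∂ 4) (I' := 𝓡 3) bC.incl gC.val z = Literature.Geometry.Lorentzian.pullbackBilin (I := 𝓡∂ 4) (I' := 𝓡 3) (bW.incl ∘ φ ∘ τ) gW.val z) ∧ (∀ z, 0 ≤ gC.meanCurvature bC.incl Literature.Geometry.Lorentzian.PseudoRiemannianMetric.contMDiff_pullbackBilin_holds hfC νC z) ∧ ∀ w, 0 ≤ gW.meanCurvature bW.incl Literature.Geometry.Lorentzian.PseudoRiemannianMetric.contMDiff_pullbackBilin_holds hfW νW w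

/-- item stmt-SmoothPoincare4-0383 · support · rank 9 · open · by planner
sources: KumarSen2025, Hamilton1997, Summit.SmoothPoincare4.SmoothPoincare4.Theses.PIC.PicPscV2
Formal over `Literature.Geometry.Lorentzian.PseudoRiemannianMetric` (IsRiemannian, scalarCurvature;
LeviCivita.lean). Necessary for the thesis (PIC ⇒ PSC). OPEN: SW/BF obstructions need b⁺ > 0,
Â-obstruction vanishes (σ = 0), minimal-hypersurface method gives nothing for π₁ = 1 in dim 4. A
homotopy 4-sphere without PSC is exotic, so refutation refutes SPC4. Sources: SchoenYau1979;
GompfStipsicz1999 §2.4; Rosenberg–Stolz surveys. -/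
@[route_item "route-SmoothPoincare4-PscCorkFillIn"]
def PscAllHomotopySpheres : Prop :=
  ∀ S : Literature.Topology.FourManifolds.HomotopySphere 4, ∃ g : Literature.Geometry.Lorentzian.PseudoRiemannianMetric (𝓡 4) ∞ (EuclideanSpace ℝ (Fin 4)) (TangentSpace (𝓡 4) : S.carrier → Type _), ∃ _ : g.HasLeviCivita, g.IsRiemannian ∧ ∀ x, 0 < g.scalarCurvature x

/-- item stmt-SmoothPoincare4-8132 · support · rank 9 · closed · moot by None · by planner
sources: ONeill1983, BarHanke2023, Literature.Geometry.Lorentzian.PseudoRiemannianMetric.comap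
[support] RESTRICTION (converse of the gluing fact; also the kill-direction engine): if P is a
boundary gluing M ∪_ψ N of compact smooth 4-manifolds with boundary (IsBoundaryGluing bM bN ψ (𝓡 4)
P) and g is a Riemannian PSC metric on P, then the pieces carry Riemannian PSC metrics (the
pullbacks along the hidden piece embeddings, `PseudoRiemannianMetric.comap`) with smooth outward
unit normals, equal boundary forms under ψ and H_M(z) + H_N(ψ z) = 0. Proof: comap along jM, jN
(injective differentials, equal dimension), naturality of Levi-Civita/scalar curvature/second
fundamental form under isometric embeddings, and ν_M^out ↦ −ν_N^out on the common hypersurface.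
[difficulty: L] -/
@[route_item "route-SmoothPoincare4-PscCorkFillIn"]
def RestrictionToPieces : Prop :=
  ∀ (M : Type) [TopologicalSpace M] [T2Space M] [SecondCountableTopology M] [ChartedSpace (EuclideanHalfSpace 4) M] [IsManifold (𝓡∂ 4) ∞ M] [CompactSpace M] (bM : Literature.Topology.FourManifolds.BoundaryData (𝓡∂ 4) M (𝓡 3)) (N : Type) [TopologicalSpace N] [T2Space N] [SecondCountableTopology N] [ChartedSpace (EuclideanHalfSpace 4) N] [IsManifold (𝓡∂ 4) ∞ N] [CompactSpace N] (bN : Literature.Topology.FourManifolds.BoundaryData (𝓡∂ 4) N (𝓡 3)) (ψ : bM.carrier ≃ₘ⟮𝓡 3, 𝓡 3⟯ bN.carrier) (P : Type) [TopologicalSpace P] [T2Space P] [SecondCountableTopology P] [ChartedSpace (EuclideanSpace ℝ (Fin 4)) P] [IsManifold (𝓡 4) ∞ P], Literature.Topology.FourManifolds.IsBoundaryGluing bM bN ψ (𝓡 4) P → ∀ (g : Literature.Geometry.Lorentzian.PseudoRiemannianMetric (𝓡 4) ∞ (EuclideanSpace ℝ (Fin 4)) (TangentSpace (𝓡 4)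 : P → Type _)) [g.HasLeviCivita], g.IsRiemannian → (∀ x, 0 < g.scalarCurvature x) → ∃ gM : Literature.Geometry.Lorentzian.PseudoRiemannianMetric (𝓡∂ 4) ∞ (EuclideanSpace ℝ (Fin 4)) (TangentSpace (𝓡∂ 4) : M → Type _), ∃ _ : gM.HasLeviCivita, ∃ hfM : gM.IsSpacelikeImmersion (𝓡 3) bM.incl, ∃ νM : Literature.Geometry.Lorentzian.NormalField (𝓡∂ 4) bM.incl, ∃ gN : Literature.Geometry.Lorentzian.PseudoRiemannianMetric (𝓡∂ 4) ∞ (EuclideanSpace ℝ (Fin 4)) (TangentSpace (𝓡∂ 4) : N → Type _), ∃ _ : gN.HasLeviCivita, ∃ hfN : gN.IsSpacelikeImmersion (𝓡 3) bN.incl, ∃ νN : Literature.Geometry.Lorentzian.NormalField (𝓡∂ 4) bN.incl, (gM.IsRiemannian ∧ (∀ x, 0 < gM.scalarCurvature x) ∧ gM.IsUnitNormal (𝓡 3) bM.incl νM 1 ∧ ContMDiff (𝓡 3) (𝓡∂ 4).tangent ∞ (fun z ↦ (Bundle.TotalSpace.mk' (EuclideanSpace ℝ (Fin 4)) (bM.incl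 z) (νM z) : TangentBundle (𝓡∂ 4) M)) ∧ (∀ z, (show EuclideanSpace ℝ (Fin 4) from νM z) 0 < 0)) ∧ (gN.IsRiemannian ∧ (∀ x, 0 < gN.scalarCurvature x) ∧ gN.IsUnitNormal (𝓡 3) bN.incl νN 1 ∧ ContMDiff (𝓡 3) (𝓡∂ 4).tangent ∞ (fun w ↦ (Bundle.TotalSpace.mk' (EuclideanSpace ℝ (Fin 4)) (bN.incl w) (νN w) : TangentBundle (𝓡∂ 4) N)) ∧ (∀ w, (show EuclideanSpace ℝ (Fin 4) from νN w) 0 < 0)) ∧ (∀ z, Literature.Geometry.Lorentzian.pullbackBilin (I := 𝓡∂ 4) (I' := 𝓡 3) bM.incl gM.val z = Literature.Geometry.Lorentzian.pullbackBilin (I := 𝓡∂ 4) (I' := 𝓡 3) (bN.incl ∘ ψ) gN.val z) ∧ ∀ z, gM.meanCurvature bM.incl Literature.Geometry.Lorentzian.PseudoRiemannianMetric.contMDiff_pullbackBilin_holds hfM νM z + gN.meanCurvature bN.incl Literature.Geometry.Lorentzian.PseudoRiemannianMetric.contMDiff_pullbackBilin_holds hfN νN (ψ z) = 0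

/-- item stmt-SmoothPoincare4-8133 · support · rank 9 · closed · moot by None · by planner
sources: ShiWangWei2022, Gromov2023, BarHanke2023
[support] FLEX-h (card K2, KNOWN): on a compact smooth 4-manifold with boundary admitting some PSC
metric (automatic when the boundary is nonempty, Gromov's h-principle), every Riemannian metric h on
the boundary is the induced boundary form of a Riemannian PSC metric: ShiWangWei2022 Thm 1.1
(answering Gromov's Question, Four Lectures pp. 31–32); moreover any mean curvature H ≤ C(X, h) can
be prescribed (loc. cit., remark after Thm 1.1). Vendoring target for the Literature programme;
provable from a PSC-cobordism collar (SWW Lemma 2.x, quasi-spherical equation). [difficulty: L] -/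
@[route_item "route-SmoothPoincare4-PscCorkFillIn"]
def FlexBoundaryMetric : Prop :=
  ∀ (C : Type) [TopologicalSpace C] [T2Space C] [SecondCountableTopology C] [ChartedSpace (EuclideanHalfSpace 4) C] [IsManifold (𝓡∂ 4) ∞ C] [CompactSpace C] (bC : Literature.Topology.FourManifolds.BoundaryData (𝓡∂ 4) C (𝓡 3)), (∃ g : Literature.Geometry.Lorentzian.PseudoRiemannianMetric (𝓡∂ 4) ∞ (EuclideanSpace ℝ (Fin 4)) (TangentSpace (𝓡∂ 4) : C → Type _), ∃ _ : g.HasLeviCivita, g.IsRiemannian ∧ ∀ x, 0 < g.scalarCurvature x) → ∀ (h : Literature.Geometry.Lorentzian.PseudoRiemannianMetric (𝓡 3) ∞ (EuclideanSpace ℝ (Fin 3)) (TangentSpace (𝓡 3) : bC.carrier → Type _)), h.IsRiemannian → ∃ g : Literature.Geometry.Lorentzian.PseudoRiemannianMetric (𝓡∂ 4) ∞ (EuclideanSpace ℝ (Fin 4)) (TangentSpace (𝓡∂ 4) : C → Type _), ∃ _ : g.HasLeviCivita, g.IsRiemannian ∧ (∀ x, 0 < g.scalarCurvature x) ∧ ∀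 z, Literature.Geometry.Lorentzian.pullbackBilin (I := 𝓡∂ 4) (I' := 𝓡 3) bC.incl g.val z = h.val z

/-- item stmt-SmoothPoincare4-8134 · support · rank 9 · closed · moot by None · by planner
sources: BarHanke2023, Literature.Geometry.Lorentzian.pullbackBilin_comp
[support] GLUE (pure logic + chain rule for pullbacks, PROVED sorry-free in the planner's
SketchProofs.lean, theorem corkSideGivesTwisted_holds): CorkSideFillIn → TwistedFillIn — pair g'
with g_W; boundary forms: incl^*g' = τ^*(incl^*g₀) = τ^*φ^*(incl_W^*g_W) via `pullbackBilin_comp`;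
mean curvature: H_{g'}(z) + H_W(φτz) ≥ H_{g₀}(τz) + H_W(φ(τz)) ≥ 0. [deps: CorkSideFillIn,
TwistedFillIn] [difficulty: provable-now] -/
@[route_item "route-SmoothPoincare4-PscCorkFillIn"]
def CorkSideGivesTwisted : Prop :=
  CorkSideFillIn → TwistedFillIn

/-- item stmt-SmoothPoincare4-8135 · support · rank 9 · closed · moot by None · by planner
sources: BarHanke2023
[support] GLUE (PROVED sorry-free in SketchProofs.lean, meanConvexPairGivesTwisted_holds):
MeanConvexTwistedPair → TwistedFillIn (add the two sign conditions). [deps: MeanConvexTwistedPair,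
TwistedFillIn] [difficulty: provable-now] -/
@[route_item "route-SmoothPoincare4-PscCorkFillIn"]
def MeanConvexPairGivesTwisted : Prop :=
  MeanConvexTwistedPair → TwistedFillIn

/-- item stmt-SmoothPoincare4-8136 · support · rank 9 · closed · moot by None · by planner
sources: BarHanke2023, Literature.Geometry.Riemannian.ricci_roundMetric
[support] GLUE (PROVED sorry-free in SketchProofs.lean, invarianceGivesCorkSide_holds): (S⁴ carries
a Riemannian PSC metric — the round one, Literature `roundMetric` + `ricci_roundMetric`) →
RestrictionToPieces → CorkFillInInvariance → CorkSideFillIn: restrict the PSC metric of S⁴ to the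
φ-compatible pair (g₀, g_W) (sum of mean curvatures = 0) and apply invariance to g₀. [deps:
RestrictionToPieces, CorkFillInInvariance, CorkSideFillIn] [difficulty: provable-now] -/
@[route_item "route-SmoothPoincare4-PscCorkFillIn"]
def InvarianceGivesCorkSide : Prop :=
  (∃ g : Literature.Geometry.Lorentzian.PseudoRiemannianMetric (𝓡 4) ∞ (EuclideanSpace ℝ (Fin 4)) (TangentSpace (𝓡 4) : (Metric.sphere (0 : EuclideanSpace ℝ (Fin 5)) 1) → Type _), ∃ _ : g.HasLeviCivita, g.IsRiemannian ∧ ∀ x, 0 < g.scalarCurvature x) → RestrictionToPieces → CorkFillInInvariance → CorkSideFillIn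

/-- item stmt-SmoothPoincare4-8137 · assembly · rank 1 · closed · moot by None · by planner
sources: BarHanke2023, Miao2002, CurtisFreedmanHsiangStong1996, Matveyev1996, KervaireMilnorAnnals1963, AkbulutMatveyev1998
[assembly] (F1: cork presentation of homotopy 4-spheres with compact smooth exterior) → (F2:
Bär–Hanke gluing of ψ-compatible PSC pairs on any boundary gluing P = M ∪_ψ N) → TwistedFillIn →
PscAllHomotopySpheres (= PIC.PicPscV2 verbatim; the sub-target wall, one necessary condition short
of SmoothPoincare4). -/
@[route_item "route-SmoothPoincare4-PscCorkFillIn"]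
def Assembly : Prop :=
  (∀ S : Literature.Topology.FourManifolds.HomotopySphere 4, ∃ (C : Type) (_ : TopologicalSpace C) (_ : T2Space C) (_ : SecondCountableTopology C) (_ : ChartedSpace (EuclideanHalfSpace 4) C) (_ : IsManifold (𝓡∂ 4) ∞ C) (_ : CompactSpace C) (_ : ContractibleSpace C) (bC : Literature.Topology.FourManifolds.BoundaryData (𝓡∂ 4) C (𝓡 3)) (W : Type) (_ : TopologicalSpace W) (_ : T2Space W) (_ : SecondCountableTopology W) (_ : ChartedSpace (EuclideanHalfSpace 4) W) (_ : IsManifold (𝓡∂ 4) ∞ W) (_ : CompactSpace W) (bW : Literature.Topology.FourManifolds.BoundaryData (𝓡∂ 4) W (𝓡 3)) (φ : bC.carrier ≃ₘ⟮𝓡 3, 𝓡 3⟯ bW.carrier) (τ : bC.carrier ≃ₘ⟮𝓡 3, 𝓡 3⟯ bC.carrier), Literature.Topology.FourManifolds.IsBoundaryGluing bC bW φ (𝓡 4) (Metric.sphere (0 : EuclideanSpace ℝ (Fin 5)) 1) ∧ Literature.Topology.FourManifolds.IsBoundaryGluing bC bW (τ.trans φ) (𝓡 4) S.carrier) → (∀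 (M : Type) [TopologicalSpace M] [T2Space M] [SecondCountableTopology M] [ChartedSpace (EuclideanHalfSpace 4) M] [IsManifold (𝓡∂ 4) ∞ M] [CompactSpace M] (bM : Literature.Topology.FourManifolds.BoundaryData (𝓡∂ 4) M (𝓡 3)) (N : Type) [TopologicalSpace N] [T2Space N] [SecondCountableTopology N] [ChartedSpace (EuclideanHalfSpace 4) N] [IsManifold (𝓡∂ 4) ∞ N] [CompactSpace N] (bN : Literature.Topology.FourManifolds.BoundaryData (𝓡∂ 4) N (𝓡 3)) (ψ : bM.carrier ≃ₘ⟮𝓡 3, 𝓡 3⟯ bN.carrier) (P : Type) [TopologicalSpace P] [T2Space P] [SecondCountableTopology P] [ChartedSpace (EuclideanSpace ℝ (Fin 4)) P] [IsManifold (𝓡 4) ∞ P], Literature.Topology.FourManifolds.IsBoundaryGluing bM bN ψ (𝓡 4) P → (∃ gM : Literature.Geometry.Lorentzian.PseudoRiemannianMetric (𝓡∂ 4) ∞ (EuclideanSpace ℝ (Fin 4)) (TangentSpace (𝓡∂ 4) : M → Type _), ∃ _ : gM.HasLeviCivita, ∃ hfM : gM.IsSpacelikeImmersion (𝓡 3)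 bM.incl, ∃ νM : Literature.Geometry.Lorentzian.NormalField (𝓡∂ 4) bM.incl, ∃ gN : Literature.Geometry.Lorentzian.PseudoRiemannianMetric (𝓡∂ 4) ∞ (EuclideanSpace ℝ (Fin 4)) (TangentSpace (𝓡∂ 4) : N → Type _), ∃ _ : gN.HasLeviCivita, ∃ hfN : gN.IsSpacelikeImmersion (𝓡 3) bN.incl, ∃ νN : Literature.Geometry.Lorentzian.NormalField (𝓡∂ 4) bN.incl, (gM.IsRiemannian ∧ (∀ x, 0 < gM.scalarCurvature x) ∧ gM.IsUnitNormal (𝓡 3) bM.incl νM 1 ∧ ContMDiff (𝓡 3) (𝓡∂ 4).tangent ∞ (fun z ↦ (Bundle.TotalSpace.mk' (EuclideanSpace ℝ (Fin 4)) (bM.incl z) (νM z) : TangentBundle (𝓡∂ 4) M)) ∧ (∀ z, (show EuclideanSpace ℝ (Fin 4) from νM z) 0 < 0)) ∧ (gN.IsRiemannian ∧ (∀ x, 0 < gN.scalarCurvature x) ∧ gN.IsUnitNormal (𝓡 3) bN.incl νN 1 ∧ ContMDiff (𝓡 3) (𝓡∂ 4).tangent ∞ (fun w ↦ (Bundle.TotalSpace.mk'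 (EuclideanSpace ℝ (Fin 4)) (bN.incl w) (νN w) : TangentBundle (𝓡∂ 4) N)) ∧ (∀ w, (show EuclideanSpace ℝ (Fin 4) from νN w) 0 < 0)) ∧ (∀ z, Literature.Geometry.Lorentzian.pullbackBilin (I := 𝓡∂ 4) (I' := 𝓡 3) bM.incl gM.val z = Literature.Geometry.Lorentzian.pullbackBilin (I := 𝓡∂ 4) (I' := 𝓡 3) (bN.incl ∘ ψ) gN.val z) ∧ ∀ z, 0 ≤ gM.meanCurvature bM.incl Literature.Geometry.Lorentzian.PseudoRiemannianMetric.contMDiff_pullbackBilin_holds hfM νM z + gN.meanCurvature bN.incl Literature.Geometry.Lorentzian.PseudoRiemannianMetric.contMDiff_pullbackBilin_holds hfN νN (ψ z)) → ∃ g : Literature.Geometry.Lorentzian.PseudoRiemannianMetric (𝓡 4) ∞ (EuclideanSpace ℝ (Fin 4)) (TangentSpace (𝓡 4) : P → Type _), ∃ _ : g.HasLeviCivita, g.IsRiemannian ∧ ∀ x, 0 < g.scalarCurvature x) → TwistedFillIn → PscAllHomotopySpheres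

end Summit.SmoothPoincare4.SmoothPoincare4.Theses.PscCorkFillIn
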